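import Summits.Langlands.Langlands.Theorems.ParityBlindBianchiArtinWeightRealisationEvenStubTwistConjugateMatrices
import HarnessLib

/-!
# Stub `stub_twistConjugateOfSignedTraces` (S4b) of the line `SketchIdeator2` for the crux
# `ParityBlindBianchi.ArtinWeightRealisationEven` (item stmt-Langlands-16619) — part 2/3:
# E4–E5, the normal form forces the twist

Helper file (`--supports stmt-Langlands-16619`).  For homomorphisms `σ r : Γ → GL₂(A)` with
`det r = det σ`, `tr r = ± tr σ` pointwise, in the DIHEDRAL NORMAL FORM `σ(g₅) = diag(l₁, l₂)`,
`σ(s) = b W`, `r(g₅) = ε₁ σ(g₅)`, `r(s) = ε₂ σ(s)` (`l₁, l₂ ≠ 0`, `l₁ ≠ l₂`, `l₁² ≠ l₂²`, `b ≠ 0`):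
(E4, `same_or_flip`) the traces of `r(g₅ⁱ q)`, `r(s g₅ⁱ q)`, `i = 0, 1, 2`, force `r(q) = ± σ(q)` or
`r(q) = ± J σ(q) J`, `J = diag(1, -1)`; (E5) both alternatives define subgroups covering `Γ`, a
group is not the union of two proper subgroups (`forall_or_forall_of_forall_or`), and on the
surviving alternative the signs form a character (`exists_character_of_forall`); whence
`exists_twist_of_normal_form`: `r = χ · M σ M⁻¹`, `χ² = 1`, `M ∈ {1, J}`.  No definition, no named
fact.
-/

-- the line's namespace `Summit.Langlands.Langlands.…` (summit = problem = `Langlands`) repeats a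
-- component by design
set_option linter.dupNamespace false

namespace Summit.Langlands.Langlands.Theorems.ArtinWeightRealisationEven

open scoped MatrixGroups Matrix
open Literature.NumberTheory.EllipticCurves.DeuringLadic (Matrix.sq_eq_trace_smul_sub_det_fin_two)
open Literature.NumberTheory.EllipticCurves.Hida2000Thm326 (one_add_pow_of_mul_self_eq_zero)

universe u v

namespace TwistConjugate

variable {A : Type*} [Field A]

section NormalForm

variable {Γ : Type u} [Group Γ]

/-- **E4.**  In the dihedral normal form (`σ(g₅) = diag(l₁, l₂)`, `σ(s) = b W`, `r(g₅) = ε₁ σ(g₅)`,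
`r(s) = ε₂ σ(s)`), the trace relations at `g₅ⁱ q` and `s g₅ⁱ q`, `i = 0, 1, 2`, force
`r(q) = ± σ(q)` or `r(q) = ± J σ(q) J`. -/
theorem same_or_flip (σ r : Γ →* GL (Fin 2) A)
    (hdt : ∀ g : Γ, Matrix.det ((r g : GL (Fin 2) A) : Matrix (Fin 2) (Fin 2) A) =
        Matrix.det ((σ g : GL (Fin 2) A) : Matrix (Fin 2) (Fin 2) A) ∧
      (Matrix.trace ((r g : GL (Fin 2) A) : Matrix (Fin 2) (Fin 2) A) =
          Matrix.trace ((σ g : GL (Fin 2) A) : Matrix (Fin 2) (Fin 2) A) ∨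
       Matrix.trace ((r g : GL (Fin 2) A) : Matrix (Fin 2) (Fin 2) A) =
          -Matrix.trace ((σ g : GL (Fin 2) A) : Matrix (Fin 2) (Fin 2) A)))
    {g₅ s : Γ} {l₁ l₂ b ε₁ ε₂ : A} (h1 : l₁ ≠ 0) (h2 : l₂ ≠ 0) (hne : l₁ ≠ l₂)
    (hsq : l₁ ^ 2 ≠ l₂ ^ 2) (hb : b ≠ 0) (hε₁ : ε₁ = 1 ∨ ε₁ = -1) (hε₂ : ε₂ = 1 ∨ ε₂ = -1)
    (hS5 : ((σ g₅ : GL (Fin 2) A) : Matrix (Fin 2) (Fin 2) A) = !![l₁, 0; 0, l₂])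
    (hSs : ((σ s : GL (Fin 2) A) : Matrix (Fin 2) (Fin 2) A) = !![0, b; b, 0])
    (hR5 : ((r g₅ : GL (Fin 2) A) : Matrix (Fin 2) (Fin 2) A) = ε₁ • !![l₁, 0; 0, l₂])
    (hRs : ((r s : GL (Fin 2) A) : Matrix (Fin 2) (Fin 2) A) = ε₂ • !![0, b; b, 0]) (q : Γ) :
    (∃ η : A, (η = 1 ∨ η = -1) ∧ ((r q : GL (Fin 2) A) : Matrix (Fin 2) (Fin 2) A) =
        η • ((σ q : GL (Fin 2) A) : Matrix (Fin 2) (Fin 2) A)) ∨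
    (∃ η : A, (η = 1 ∨ η = -1) ∧ ((r q : GL (Fin 2) A) : Matrix (Fin 2) (Fin 2) A) =
        η • (!![(1 : A), 0; 0, -1] * ((σ q : GL (Fin 2) A) : Matrix (Fin 2) (Fin 2) A) *
          !![(1 : A), 0; 0, -1])) := by
  have hε₁sq : ε₁ ^ 2 = 1 := by rcases hε₁ with h | h <;> simp [h]
  have hε₂₁ : ε₂ * ε₁ = 1 ∨ ε₂ * ε₁ = -1 := by
    rcases hε₁ with h | h <;> rcases hε₂ with h' | h' <;> simp [h, h']
  have t0 := (hdt q).2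
  have t1 := (hdt (g₅ * q)).2
  have t2 := (hdt (g₅ * g₅ * q)).2
  have u0 := (hdt (s * q)).2
  have u1 := (hdt (s * g₅ * q)).2
  have u2 := (hdt (s * g₅ * g₅ * q)).2
  simp only [map_mul, Units.val_mul, hS5, hSs, hR5, hRs] at t1 t2 u0 u1 u2
  set Y := ((r q : GL (Fin 2) A) : Matrix (Fin 2) (Fin 2) A) with hY
  set Z := ((σ q : GL (Fin 2) A) : Matrix (Fin 2) (Fin 2) A) with hZ
  -- normalise the six trace relations
  rw [Matrix.trace_fin_two, Matrix.trace_fin_two] at t0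
  rw [Matrix.smul_mul, Matrix.trace_smul, trace_diag_mul, trace_diag_mul, smul_eq_mul] at t1
  rw [Matrix.smul_mul, Matrix.mul_smul, smul_smul, Matrix.smul_mul, Matrix.trace_smul, ← sq,
    diag_mul_diag, trace_diag_mul, trace_diag_mul, smul_eq_mul, hε₁sq, one_mul] at t2
  rw [Matrix.smul_mul, Matrix.trace_smul, trace_antidiag_mul, trace_antidiag_mul, smul_eq_mul,
    ← mul_assoc] at u0
  rw [Matrix.smul_mul, Matrix.mul_smul, smul_smul, Matrix.smul_mul, Matrix.trace_smul,
    trace_antidiag_diag_mul, trace_antidiag_diag_mul, smul_eq_mul, ← mul_assoc] at u1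
  have cu2 : ((ε₂ • !![0, b; b, 0]) * (ε₁ • !![l₁, 0; 0, l₂]) * (ε₁ • !![l₁, 0; 0, l₂]) * Y).trace =
      ε₂ * b * (l₁ ^ 2 * Y 0 1 + l₂ ^ 2 * Y 1 0) := by
    simp [Matrix.trace_fin_two, Fin.sum_univ_two, Matrix.vecMul, dotProduct]
    linear_combination ε₂ * b * (l₁ ^ 2 * Y 0 1 + l₂ ^ 2 * Y 1 0) * hε₁sq
  have cz2 : (!![0, b; b, 0] * !![l₁, 0; 0, l₂] * !![l₁, 0; 0, l₂] * Z).trace =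
      b * (l₁ ^ 2 * Z 0 1 + l₂ ^ 2 * Z 1 0) := by
    simp [Matrix.trace_fin_two, Fin.sum_univ_two, Matrix.vecMul, dotProduct]
    ring
  rw [cu2, cz2] at u2
  -- signs off
  have e1 := sign_cancel hε₁ t1
  have f0 := sign_cancel_mul hb hε₂ u0
  have f1 := sign_cancel_mul hb hε₂₁ u1
  have f2 := sign_cancel_mul hb hε₂ u2
  obtain ⟨η, hη, hu, hv⟩ := sign_lemma h1 h2 hne hsq t0 e1 t2
  obtain ⟨η', hη', hu', hv'⟩ := sign_lemma h1 h2 hne hsq f0 f1 f2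
  rcases hη with rfl | rfl <;> rcases hη' with rfl | rfl
  · refine Or.inl ⟨1, Or.inl rfl, ?_⟩
    ext i j
    fin_cases i <;> fin_cases j <;> simp [hu, hv, hu', hv']
  · refine Or.inr ⟨1, Or.inl rfl, ?_⟩
    rw [J_mul_mul_J]
    ext i j
    fin_cases i <;> fin_cases j <;> simp [hu, hv, hu', hv']
  · refine Or.inr ⟨-1, Or.inr rfl, ?_⟩
    rw [J_mul_mul_J]
    ext i j
    fin_cases i <;> fin_cases j <;> simp [hu, hv, hu', hv']
  · refine Or.inl ⟨-1, Or.inr rfl, ?_⟩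
    ext i j
    fin_cases i <;> fin_cases j <;> simp [hu, hv, hu', hv']

/-- Closure of "`r = ± σ''`" under products. -/
theorem same_mul (ρ τ : Γ →* GL (Fin 2) A) {x y : Γ}
    (hx : ∃ η : A, (η = 1 ∨ η = -1) ∧ ((ρ x : GL (Fin 2) A) : Matrix (Fin 2) (Fin 2) A) =
      η • ((τ x : GL (Fin 2) A) : Matrix (Fin 2) (Fin 2) A))
    (hy : ∃ η : A, (η = 1 ∨ η = -1) ∧ ((ρ y : GL (Fin 2) A) : Matrix (Fin 2) (Fin 2) A) =
      η • ((τ y : GL (Fin 2) A) : Matrix (Fin 2) (Fin 2) A)) :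
    ∃ η : A, (η = 1 ∨ η = -1) ∧ ((ρ (x * y) : GL (Fin 2) A) : Matrix (Fin 2) (Fin 2) A) =
      η • ((τ (x * y) : GL (Fin 2) A) : Matrix (Fin 2) (Fin 2) A) := by
  obtain ⟨η, hη, hx⟩ := hx
  obtain ⟨η', hη', hy⟩ := hy
  refine ⟨η * η', ?_, ?_⟩
  · rcases hη with rfl | rfl <;> rcases hη' with rfl | rfl <;> simp
  · rw [map_mul, map_mul, Units.val_mul, Units.val_mul, hx, hy, Matrix.smul_mul, Matrix.mul_smul,
      smul_smul]

/-- Closure of "`r = ± σ''`" under inverses. -/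
theorem same_inv (ρ τ : Γ →* GL (Fin 2) A) {x : Γ}
    (hx : ∃ η : A, (η = 1 ∨ η = -1) ∧ ((ρ x : GL (Fin 2) A) : Matrix (Fin 2) (Fin 2) A) =
      η • ((τ x : GL (Fin 2) A) : Matrix (Fin 2) (Fin 2) A)) :
    ∃ η : A, (η = 1 ∨ η = -1) ∧ ((ρ x⁻¹ : GL (Fin 2) A) : Matrix (Fin 2) (Fin 2) A) =
      η • ((τ x⁻¹ : GL (Fin 2) A) : Matrix (Fin 2) (Fin 2) A) := by
  obtain ⟨η, hη, hx⟩ := hx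
  have hηη : η * η = 1 := by rcases hη with rfl | rfl <;> simp
  refine ⟨η, hη, ?_⟩
  have hRR : ((ρ x⁻¹ : GL (Fin 2) A) : Matrix (Fin 2) (Fin 2) A) *
      ((ρ x : GL (Fin 2) A) : Matrix (Fin 2) (Fin 2) A) = 1 := by
    rw [← Units.val_mul, ← map_mul, inv_mul_cancel, map_one, Units.val_one]
  have hSS : ((τ x : GL (Fin 2) A) : Matrix (Fin 2) (Fin 2) A) *
      ((τ x⁻¹ : GL (Fin 2) A) : Matrix (Fin 2) (Fin 2) A) = 1 := by
    rw [← Units.val_mul, ← map_mul, mul_inv_cancel, map_one, Units.val_one]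
  have hSx : ((τ x : GL (Fin 2) A) : Matrix (Fin 2) (Fin 2) A) =
      η • ((ρ x : GL (Fin 2) A) : Matrix (Fin 2) (Fin 2) A) := by
    rw [hx, smul_smul, hηη, one_smul]
  calc ((ρ x⁻¹ : GL (Fin 2) A) : Matrix (Fin 2) (Fin 2) A)
      = ((ρ x⁻¹ : GL (Fin 2) A) : Matrix (Fin 2) (Fin 2) A) *
          (((τ x : GL (Fin 2) A) : Matrix (Fin 2) (Fin 2) A) *
            ((τ x⁻¹ : GL (Fin 2) A) : Matrix (Fin 2) (Fin 2) A)) := by rw [hSS, Matrix.mul_one]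
    _ = η • ((τ x⁻¹ : GL (Fin 2) A) : Matrix (Fin 2) (Fin 2) A) := by
        rw [hSx, Matrix.smul_mul, Matrix.mul_smul, ← Matrix.mul_assoc, hRR, Matrix.one_mul]

/-- A group is not the union of two proper subgroups (predicate form). -/
theorem forall_or_forall_of_forall_or {P Q : Γ → Prop}
    (hPmul : ∀ x y, P x → P y → P (x * y)) (hPinv : ∀ x, P x → P x⁻¹)
    (hQmul : ∀ x y, Q x → Q y → Q (x * y)) (hQinv : ∀ x, Q x → Q x⁻¹)
    (h : ∀ x, P x ∨ Q x) : (∀ x, P x) ∨ (∀ x, Q x) := by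
  by_contra hc
  rw [not_or, not_forall, not_forall] at hc
  obtain ⟨⟨a, ha⟩, ⟨c, hc'⟩⟩ := hc
  have hQa : Q a := (h a).resolve_left ha
  have hPc : P c := (h c).resolve_right hc'
  rcases h (a * c) with hac | hac
  · exact ha (by simpa using hPmul _ _ hac (hPinv _ hPc))
  · exact hc' (by simpa using hQmul _ _ (hQinv _ hQa) hac)

/-- From "`r(q) = ± σ''(q)` for every `q`" to a character `χ` with `χ² = 1` and `r = χ σ''`. -/
theorem exists_character_of_forall (τ ρ : Γ →* GL (Fin 2) A)
    (h : ∀ q, ∃ η : A, (η = 1 ∨ η = -1) ∧ ((ρ q : GL (Fin 2) A) : Matrix (Fin 2) (Fin 2) A) =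
      η • ((τ q : GL (Fin 2) A) : Matrix (Fin 2) (Fin 2) A)) :
    ∃ χ : Γ →* Aˣ, (∀ g, χ g ^ 2 = 1) ∧ ∀ g, ((ρ g : GL (Fin 2) A) : Matrix (Fin 2) (Fin 2) A) =
      ((χ g : Aˣ) : A) • ((τ g : GL (Fin 2) A) : Matrix (Fin 2) (Fin 2) A) := by
  choose f hf1 hf2 using h
  have hff : ∀ q, f q * f q = 1 := fun q => by rcases hf1 q with h | h <;> simp [h]
  have hdetS : ∀ q, ((τ q : GL (Fin 2) A) : Matrix (Fin 2) (Fin 2) A).det ≠ 0 := fun q =>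
    ((Matrix.isUnit_iff_isUnit_det _).mp (τ q).isUnit).ne_zero
  have hmul : ∀ x y, f (x * y) = f x * f y := by
    intro x y
    apply smul_left_cancel_of_det_ne_zero (hdetS (x * y))
    rw [← hf2 (x * y), map_mul ρ, Units.val_mul, hf2 x, hf2 y, Matrix.smul_mul, Matrix.mul_smul,
      smul_smul, map_mul τ, Units.val_mul]
  refine ⟨MonoidHom.mk' (fun q => Units.mkOfMulEqOne (f q) (f q) (hff q)) ?_, ?_, ?_⟩
  · intro x y
    ext
    simp [Units.val_mkOfMulEqOne, hmul]
  · intro g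
    ext
    simp [Units.val_mkOfMulEqOne, sq, hff]
  · intro g
    simp only [MonoidHom.mk'_apply, Units.val_mkOfMulEqOne]
    exact hf2 g

/-- **E4 + E5.**  In the dihedral normal form, `r = χ · M σ M⁻¹` with `χ² = 1` and
`M ∈ {1, J}`. -/
theorem exists_twist_of_normal_form (σ r : Γ →* GL (Fin 2) A)
    (hdt : ∀ g : Γ, Matrix.det ((r g : GL (Fin 2) A) : Matrix (Fin 2) (Fin 2) A) =
        Matrix.det ((σ g : GL (Fin 2) A) : Matrix (Fin 2) (Fin 2) A) ∧
      (Matrix.trace ((r g : GL (Fin 2) A) : Matrix (Fin 2) (Fin 2) A) =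
          Matrix.trace ((σ g : GL (Fin 2) A) : Matrix (Fin 2) (Fin 2) A) ∨
       Matrix.trace ((r g : GL (Fin 2) A) : Matrix (Fin 2) (Fin 2) A) =
          -Matrix.trace ((σ g : GL (Fin 2) A) : Matrix (Fin 2) (Fin 2) A)))
    {g₅ s : Γ} {l₁ l₂ b ε₁ ε₂ : A} (h1 : l₁ ≠ 0) (h2 : l₂ ≠ 0) (hne : l₁ ≠ l₂)
    (hsq : l₁ ^ 2 ≠ l₂ ^ 2) (hb : b ≠ 0) (hε₁ : ε₁ = 1 ∨ ε₁ = -1) (hε₂ : ε₂ = 1 ∨ ε₂ = -1)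
    (hS5 : ((σ g₅ : GL (Fin 2) A) : Matrix (Fin 2) (Fin 2) A) = !![l₁, 0; 0, l₂])
    (hSs : ((σ s : GL (Fin 2) A) : Matrix (Fin 2) (Fin 2) A) = !![0, b; b, 0])
    (hR5 : ((r g₅ : GL (Fin 2) A) : Matrix (Fin 2) (Fin 2) A) = ε₁ • !![l₁, 0; 0, l₂])
    (hRs : ((r s : GL (Fin 2) A) : Matrix (Fin 2) (Fin 2) A) = ε₂ • !![0, b; b, 0]) :
    ∃ (χ : Γ →* Aˣ) (M : GL (Fin 2) A), (∀ g, χ g ^ 2 = 1) ∧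
      ∀ g : Γ, ((r g : GL (Fin 2) A) : Matrix (Fin 2) (Fin 2) A) =
        ((χ g : Aˣ) : A) • ((M * σ g * M⁻¹ : GL (Fin 2) A) : Matrix (Fin 2) (Fin 2) A) := by
  have hJdet : (!![(1 : A), 0; 0, -1] : Matrix (Fin 2) (Fin 2) A).det ≠ 0 := by
    simp [Matrix.det_fin_two_of]
  set J : GL (Fin 2) A := Matrix.GeneralLinearGroup.mkOfDetNeZero _ hJdet with hJ
  have hJval : ((J : GL (Fin 2) A) : Matrix (Fin 2) (Fin 2) A) = !![(1 : A), 0; 0, -1] := rfl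
  have hJJ : J * J = 1 := by
    ext : 1
    rw [Units.val_mul, hJval, J_mul_J, Units.val_one]
  have hJinv : J⁻¹ = J := inv_eq_of_mul_eq_one_right hJJ
  set σ' : Γ →* GL (Fin 2) A := (MulAut.conj J).toMonoidHom.comp σ with hσ'def
  have hσ' : ∀ q, ((σ' q : GL (Fin 2) A) : Matrix (Fin 2) (Fin 2) A) =
      !![(1 : A), 0; 0, -1] * ((σ q : GL (Fin 2) A) : Matrix (Fin 2) (Fin 2) A) *
        !![(1 : A), 0; 0, -1] := by
    intro q
    change (((J * σ q * J⁻¹ : GL (Fin 2) A)) : Matrix (Fin 2) (Fin 2) A) = _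
    rw [hJinv, Units.val_mul, Units.val_mul, hJval]
  have hdich := same_or_flip σ r hdt h1 h2 hne hsq hb hε₁ hε₂ hS5 hSs hR5 hRs
  have key := forall_or_forall_of_forall_or
    (P := fun q => ∃ η : A, (η = 1 ∨ η = -1) ∧ ((r q : GL (Fin 2) A) : Matrix (Fin 2) (Fin 2) A) =
      η • ((σ q : GL (Fin 2) A) : Matrix (Fin 2) (Fin 2) A))
    (Q := fun q => ∃ η : A, (η = 1 ∨ η = -1) ∧ ((r q : GL (Fin 2) A) : Matrix (Fin 2) (Fin 2) A) =
      η • ((σ' q : GL (Fin 2) A) : Matrix (Fin 2) (Fin 2) A))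
    (fun x y hx hy => same_mul r σ hx hy) (fun x hx => same_inv r σ hx)
    (fun x y hx hy => same_mul r σ' hx hy) (fun x hx => same_inv r σ' hx)
    (fun x => (hdich x).imp id (fun ⟨η, hη, e⟩ => ⟨η, hη, by rw [hσ', e]⟩))
  rcases key with hall | hall
  · obtain ⟨χ, hχ, hr⟩ := exists_character_of_forall σ r hall
    refine ⟨χ, 1, hχ, fun g => ?_⟩
    rw [hr g, one_mul, inv_one, mul_one]
  · obtain ⟨χ, hχ, hr⟩ := exists_character_of_forall σ' r hall
    refine ⟨χ, J, hχ, fun g => ?_⟩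
    rw [hr g]
    rfl

end NormalForm

end TwistConjugate

open TwistConjugate in
/-- Registered sub-goal of S4b (closed form of `exists_twist_of_normal_form`): in the dihedral normal
form the trace/determinant relations force `r = χ · M σ M⁻¹` with `χ² = 1`. -/
theorem stub_twistOfNormalForm :
    ∀ (Γ : Type u) [Group Γ] (A : Type v) [Field A] (σ r : Γ →* GL (Fin 2) A), (∀ g : Γ, Matrix.det ((r g : GL (Fin 2) A) : Matrix (Fin 2) (Fin 2) A) = Matrix.det ((σ g : GL (Fin 2) A) : Matrix (Fin 2) (Fin 2) A) ∧ (Matrix.trace ((r g : GL (Fin 2) A) : Matrix (Fin 2) (Fin 2) A) = Matrix.trace ((σ g : GL (Fin 2) A) : Matrix (Fin 2) (Fin 2) A) ∨ Matrix.trace ((r g : GL (Fin 2) A) : Matrix (Fin 2) (Fin 2) A) = -Matrix.trace ((σ g : GL (Fin 2) A) : Matrix (Fin 2) (Fin 2) A))) → ∀ (g₅ s : Γ) (l₁ l₂ b ε₁ ε₂ : A), l₁ ≠ 0 → l₂ ≠ 0 → l₁ ≠ l₂ → l₁ ^ 2 ≠ l₂ ^ 2 → b ≠ 0 → (ε₁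 = 1 ∨ ε₁ = -1) → (ε₂ = 1 ∨ ε₂ = -1) → ((σ g₅ : GL (Fin 2) A) : Matrix (Fin 2) (Fin 2) A) = !![l₁, 0; 0, l₂] → ((σ s : GL (Fin 2) A) : Matrix (Fin 2) (Fin 2) A) = !![0, b; b, 0] → ((r g₅ : GL (Fin 2) A) : Matrix (Fin 2) (Fin 2) A) = ε₁ • !![l₁, 0; 0, l₂] → ((r s : GL (Fin 2) A) : Matrix (Fin 2) (Fin 2) A) = ε₂ • !![0, b; b, 0] → ∃ (χ : Γ →* Aˣ) (M : GL (Fin 2) A), (∀ g, χ g ^ 2 = 1) ∧ ∀ g : Γ, ((r g : GL (Fin 2) A) : Matrix (Fin 2) (Fin 2) A) = ((χ g : Aˣ) : A) • ((M * σ g * M⁻¹ : GL (Fin 2) A) : Matrix (Fin 2) (Fin 2) A) :=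
  fun _ _ _ _ σ r hdt _ _ _ _ _ _ _ h1 h2 hne hsq hb hε₁ hε₂ hS5 hSs hR5 hRs =>
    exists_twist_of_normal_form σ r hdt h1 h2 hne hsq hb hε₁ hε₂ hS5 hSs hR5 hRs


end Summit.Langlands.Langlands.Theorems.ArtinWeightRealisationEven
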